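import Mathlib
import HarnessLib
import Summits.HubbardSuperconductivity.HubbardSuperconductivity.Theorems.KLProgrammeC4aPPKernelTrueNumerator

/-!
# Route `KLProgramme` — crux C4a, S3 brick (B4) «(B4)-UMK1», «(M1)-TRUE-KERNEL» adaptation (a): the TWO-SCALE numerator (loop weight at scale `Λ₁`, partner weight
# at scale `Λ₂`) — definition, symmetry and level derivatives everywhere

Cell `gate-hubbard-kl`, seat hubbard-kl-k3c3-p1 (g15; row «δμ-flow with klAngularMean constant piece»).  Companion of `…C4aPPKernelTrueNumerator` for the (C)-closer's
instantiation with c4a-1's SLICE lines (`sliceWeightFn Λ Λ′ = W_Λ − W_{Λ′}`, the second shell at the tube/UV scale `Λ′`): by bilinearity the slice pair numerator is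
`N_{Λ,Λ} − N_{Λ,Λ′} − N_{Λ′,Λ} + N_{Λ′,Λ′}` with the two-scale numerator
`N_{Λ₁,Λ₂}(e,u) = (2/β)Σ_{n≥0} W_{Λ₁}(ωₙ,e)·W_{Λ₂}(ωₙ,u)·[e/(ωₙ²+e²) + u/(ωₙ²+u²)]` (`ppTwoScaleNumerator`); `N_{Λ,Λ} = ppTrueNumerator β Λ` is the term of
`…TrueFlatnessShape` (the `A₁·lo/max(D,lo)²` slot); the terms with a `Λ′` factor are UV-smooth (`…C4aPPKernelTwoScaleUV`: the `A₃` slot).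
* `ppTwoScaleNumerator`, `ppTwoScaleNumeratorDu`, `ppTwoScaleNumerator_eq_true` (`Λ₁ = Λ₂`), `ppTwoScaleNumerator_symm` (`N_{Λ₁,Λ₂}(e,u) = N_{Λ₂,Λ₁}(u,e)`);
* **`hasDerivAt_ppTwoScaleNumerator_u / _e`** — termwise differentiation everywhere (dominator keyed to the partner scale).
Pure real analysis; nothing asserts (C), K3 or superconductivity.
References: BGM 2006 §2.1, §2.4 [cite: BenfattoGiulianiMastropietro2006]; Salmhofer 1999 §4.2.5 (4.70)–(4.71) [cite: Salmhofer1999].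
-/

noncomputable section

namespace Summit.HubbardSuperconductivity.HubbardSuperconductivity.Theorems.C4a

set_option linter.dupNamespace false -- summit = problem name (single-conjunct summit), D-0017

open Real Filter Set
open scoped Topology
open Literature.MathematicalPhysics.QuantumLattice Literature.Analysis.SpecialFunctions

/-- **The two-scale numerator**: `N_{Λ₁,Λ₂}(e,u) = (2/β)Σ_{n≥0} W_{Λ₁}(ωₙ,e)·W_{Λ₂}(ωₙ,u)·[e/(ωₙ²+e²) + u/(ωₙ²+u²)]`. -/
def ppTwoScaleNumerator (β Λ₁ Λ₂ e u : ℝ) : ℝ :=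
  2 / β * ∑' n : ℕ, uvWeightFn Λ₁ (ppFreq β n) e * uvWeightFn Λ₂ (ppFreq β n) u *
    (e / (ppFreq β n ^ 2 + e ^ 2) + u / (ppFreq β n ^ 2 + u ^ 2))

/-- **Its `u`-derivative series**: `(2/β)Σₙ W_{Λ₁}(ωₙ,e)·[W′_{Λ₂}(ωₙ,u)·(e/(ωₙ²+e²) + u/(ωₙ²+u²)) + W_{Λ₂}(ωₙ,u)·(ωₙ²−u²)/(ωₙ²+u²)²]`. -/
def ppTwoScaleNumeratorDu (β Λ₁ Λ₂ e u : ℝ) : ℝ :=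
  2 / β * ∑' n : ℕ, uvWeightFn Λ₁ (ppFreq β n) e *
    (uvWeightFnD1 Λ₂ (ppFreq β n) u * (e / (ppFreq β n ^ 2 + e ^ 2) + u / (ppFreq β n ^ 2 + u ^ 2)) +
      uvWeightFn Λ₂ (ppFreq β n) u * ((ppFreq β n ^ 2 - u ^ 2) / (ppFreq β n ^ 2 + u ^ 2) ^ 2))

/-- Equal scales give back the true numerator and its derivative series. [folklore] -/
theorem ppTwoScaleNumerator_eq_true (β Λ : ℝ) :
    ppTwoScaleNumerator β Λ Λ = ppTrueNumerator β Λ ∧ ppTwoScaleNumeratorDu β Λ Λ = ppTrueNumeratorDu β Λ := ⟨rfl, rfl⟩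

/-- **Symmetry**: `N_{Λ₁,Λ₂}(e,u) = N_{Λ₂,Λ₁}(u,e)`. [folklore] -/
theorem ppTwoScaleNumerator_symm (β Λ₁ Λ₂ e u : ℝ) : ppTwoScaleNumerator β Λ₁ Λ₂ e u = ppTwoScaleNumerator β Λ₂ Λ₁ u e := by
  unfold ppTwoScaleNumerator
  congr 1
  exact tsum_congr fun n => by ring

/-- **`∂ᵤN` exists everywhere and is the series `ppTrueNumeratorDu`** (termwise differentiation; dominator from the shell majorant of `W′`, the bound
`|x/(ω²+x²)| ≤ |x|/ω² ≤ |x|β²/π²·…`-free form `≤ (β/π)·…`, and `|∂Lorentzian| ≤ 1/ω²`). [cite: BenfattoGiulianiMastropietro2006, §2.4 (2.36)] -/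
theorem hasDerivAt_ppTwoScaleNumerator_u {β Λ₁ Λ₂ : ℝ} (hβ : 0 < β) (hΛ₂ : 0 < Λ₂) {B₁ : ℝ} (hB₁ : ∀ x, |deriv salmhoferCutoff x| ≤ B₁) (e u : ℝ) :
    HasDerivAt (fun v => ppTwoScaleNumerator β Λ₁ Λ₂ e v) (ppTwoScaleNumeratorDu β Λ₁ Λ₂ e u) u := by
  have hB0 := salmhoferB₁_nonneg hB₁
  unfold ppTwoScaleNumerator ppTwoScaleNumeratorDu
  refine HasDerivAt.const_mul (2 / β) ?_
  -- the dominator: |e|-dependent through the Lorentzian of the loop line, `|e/(ω²+e²)| ≤ |e|/ω²`, and `|v/(ω²+v²)| ≤ 1/(2ω) ≤ β/(2π)` uniformly in `v`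
  have hω : ∀ n : ℕ, 0 < ppFreq β n := ppFreq_pos hβ
  have hωπ : ∀ n : ℕ, 1 / ppFreq β n ≤ β / π := fun n => by
    rw [div_le_div_iff₀ (hω n) Real.pi_pos, one_mul]
    have := pi_div_le_ppFreq hβ n
    rw [div_le_iff₀ hβ] at this
    linarith
  refine hasDerivAt_tsum (u := fun n : ℕ => 2 * B₁ / Λ₂ * (2 * Λ₂ ^ 2 / (ppFreq β n ^ 2 + Λ₂ ^ 2)) * (|e| * (β / π) ^ 2 + β / π) +
      1 / (ppFreq β n ^ 2 + 0 ^ 2))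
    (g := fun (n : ℕ) (v : ℝ) => uvWeightFn Λ₁ (ppFreq β n) e * uvWeightFn Λ₂ (ppFreq β n) v *
      (e / (ppFreq β n ^ 2 + e ^ 2) + v / (ppFreq β n ^ 2 + v ^ 2)))
    (g' := fun (n : ℕ) (v : ℝ) => uvWeightFn Λ₁ (ppFreq β n) e *
      (uvWeightFnD1 Λ₂ (ppFreq β n) v * (e / (ppFreq β n ^ 2 + e ^ 2) + v / (ppFreq β n ^ 2 + v ^ 2)) +
        uvWeightFn Λ₂ (ppFreq β n) v * ((ppFreq β n ^ 2 - v ^ 2) / (ppFreq β n ^ 2 + v ^ 2) ^ 2)))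
    (summable_ppDominator (Λ := Λ₂) hβ B₁ _) (fun n v => ?_) (fun n v => ?_) (y₀ := 0) ?_ u
  · -- termwise derivative
    have hW : HasDerivAt (fun v => uvWeightFn Λ₂ (ppFreq β n) v) (uvWeightFnD1 Λ₂ (ppFreq β n) v) v := hasDerivAt_uvWeightFn Λ₂ (ppFreq β n) v
    have hL : HasDerivAt (fun y : ℝ => y / (ppFreq β n ^ 2 + y ^ 2)) ((ppFreq β n ^ 2 - v ^ 2) / (ppFreq β n ^ 2 + v ^ 2) ^ 2) v :=
      hasDerivAt_lorentzian (ppFreq β n) (by have := hω n; positivity)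
    have h := ((hW.fun_mul (hL.const_add (e / (ppFreq β n ^ 2 + e ^ 2)))).const_mul (uvWeightFn Λ₁ (ppFreq β n) e))
    refine (h.congr_of_eventuallyEq (Eventually.of_forall fun y => by ring)).congr_deriv ?_
    ring
  · -- the dominator
    rw [Real.norm_eq_abs, abs_mul]
    have hWe : |uvWeightFn Λ₁ (ppFreq β n) e| ≤ 1 := abs_uvWeightFn_le_one _ _ _
    have hWv : |uvWeightFn Λ₂ (ppFreq β n) v| ≤ 1 := abs_uvWeightFn_le_one _ _ _
    have hD1 := abs_uvWeightFnD1_le_shell hB₁ hΛ₂ (ppFreq β n) v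
    have hLe : |e / (ppFreq β n ^ 2 + e ^ 2)| ≤ |e| * (β / π) ^ 2 := by
      refine (abs_lorentzian_le_abs_div_sq (hω n).ne' e).trans ?_
      rw [div_eq_mul_one_div]
      refine mul_le_mul_of_nonneg_left ?_ (abs_nonneg e)
      rw [one_div_le (pow_pos (hω n) 2) (by positivity)]
      have h1 := hωπ n
      have h2 : 0 < β / π := by positivity
      calc 1 / (β / π) ^ 2 = (1 / (β / π)) ^ 2 := by rw [one_div_pow]
        _ ≤ ppFreq β n ^ 2 := by
            have h3 : 1 / (β / π) ≤ ppFreq β n := by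
              rw [one_div_le h2 (hω n)]; exact h1
            exact pow_le_pow_left₀ (by positivity) h3 2
    have hLv : |v / (ppFreq β n ^ 2 + v ^ 2)| ≤ β / π := by
      rcases le_or_gt v 0 with hv | hv
      · rcases eq_or_lt_of_le hv with rfl | hv'
        · simp; positivity
        · rw [abs_of_neg (div_neg_of_neg_of_pos hv' (by have := hω n; positivity))]
          have := lorentzian_le_inv (ω := ppFreq β n) (neg_pos.2 hv')
          rw [neg_sq] at this
          have h4 : 1 / (-v) ≤ β / π ∨ -v / (ppFreq β n ^ 2 + (v) ^ 2) ≤ 1 / ppFreq β n := by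
            right
            rw [div_le_div_iff₀ (by have := hω n; positivity) (hω n)]
            nlinarith [sq_nonneg (ppFreq β n + v), sq_nonneg (ppFreq β n - (-v)), hω n]
          rcases h4 with h4 | h4
          · have h5 : -(v / (ppFreq β n ^ 2 + v ^ 2)) = -v / (ppFreq β n ^ 2 + v ^ 2) := by ring
            rw [h5]; exact (this.trans h4)
          · have h5 : -(v / (ppFreq β n ^ 2 + v ^ 2)) = -v / (ppFreq β n ^ 2 + v ^ 2) := by ring
            rw [h5]; exact h4.trans (hωπ n)
      · rw [abs_of_nonneg (lorentzian_nonneg _ hv.le)]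
        have h4 : v / (ppFreq β n ^ 2 + v ^ 2) ≤ 1 / ppFreq β n := by
          rw [div_le_div_iff₀ (by have := hω n; positivity) (hω n)]
          nlinarith [sq_nonneg (ppFreq β n - v), hω n]
        exact h4.trans (hωπ n)
    have hL' : |(ppFreq β n ^ 2 - v ^ 2) / (ppFreq β n ^ 2 + v ^ 2) ^ 2| ≤ 1 / (ppFreq β n ^ 2 + 0 ^ 2) := by
      rw [zero_pow two_ne_zero, add_zero]; exact abs_lorentzian_deriv_le (hω n).ne' v
    calc |uvWeightFn Λ₁ (ppFreq β n) e| *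
          |uvWeightFnD1 Λ₂ (ppFreq β n) v * (e / (ppFreq β n ^ 2 + e ^ 2) + v / (ppFreq β n ^ 2 + v ^ 2)) +
            uvWeightFn Λ₂ (ppFreq β n) v * ((ppFreq β n ^ 2 - v ^ 2) / (ppFreq β n ^ 2 + v ^ 2) ^ 2)|
        ≤ 1 * (2 * B₁ / Λ₂ * (2 * Λ₂ ^ 2 / (ppFreq β n ^ 2 + Λ₂ ^ 2)) * (|e| * (β / π) ^ 2 + β / π) + 1 / (ppFreq β n ^ 2 + 0 ^ 2)) := by
          refine mul_le_mul hWe ?_ (abs_nonneg _) zero_le_one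
          refine (abs_add_le _ _).trans (add_le_add ?_ ?_)
          · rw [abs_mul]
            exact mul_le_mul hD1 ((abs_add_le _ _).trans (add_le_add hLe hLv)) (abs_nonneg _) (by positivity)
          · rw [abs_mul]
            calc |uvWeightFn Λ₂ (ppFreq β n) v| * |(ppFreq β n ^ 2 - v ^ 2) / (ppFreq β n ^ 2 + v ^ 2) ^ 2|
                ≤ 1 * (1 / (ppFreq β n ^ 2 + 0 ^ 2)) := mul_le_mul hWv hL' (abs_nonneg _) zero_le_one
              _ = 1 / (ppFreq β n ^ 2 + 0 ^ 2) := one_mul _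
      _ = _ := one_mul _
  · -- convergence at `v = 0`
    have h0 : ∀ n : ℕ, uvWeightFn Λ₁ (ppFreq β n) e * uvWeightFn Λ₂ (ppFreq β n) 0 *
        (e / (ppFreq β n ^ 2 + e ^ 2) + 0 / (ppFreq β n ^ 2 + 0 ^ 2)) =
        uvWeightFn Λ₁ (ppFreq β n) e * uvWeightFn Λ₂ (ppFreq β n) 0 * (e / (ppFreq β n ^ 2 + e ^ 2)) := fun n => by
      rw [zero_div, add_zero]
    simp_rw [h0]
    refine Summable.of_norm_bounded ((summable_one_div_ppFreq_sq_add_sq hβ 0).mul_left |e|) fun n => ?_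
    rw [Real.norm_eq_abs, abs_mul, abs_mul, zero_pow two_ne_zero, add_zero]
    have h1 := abs_lorentzian_le_abs_div_sq (hω n).ne' e
    calc |uvWeightFn Λ₁ (ppFreq β n) e| * |uvWeightFn Λ₂ (ppFreq β n) 0| * |e / (ppFreq β n ^ 2 + e ^ 2)|
        ≤ 1 * 1 * (|e| / ppFreq β n ^ 2) :=
          mul_le_mul (mul_le_mul (abs_uvWeightFn_le_one _ _ _) (abs_uvWeightFn_le_one _ _ _) (abs_nonneg _) zero_le_one) h1
            (abs_nonneg _) (by positivity)
      _ = |e| * (1 / ppFreq β n ^ 2) := by ring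

/-- **`∂ₑN₂` exists everywhere**: `∂ₑN₂(Λ₁,Λ₂)(e,u) = ppTwoScaleNumeratorDu β Λ₂ Λ₁ u e` (by the scale-swapping symmetry).
[cite: BenfattoGiulianiMastropietro2006, §2.4 (2.36)] -/
theorem hasDerivAt_ppTwoScaleNumerator_e {β Λ₁ Λ₂ : ℝ} (hβ : 0 < β) (hΛ₁ : 0 < Λ₁) {B₁ : ℝ} (hB₁ : ∀ x, |deriv salmhoferCutoff x| ≤ B₁) (e u : ℝ) :
    HasDerivAt (fun x => ppTwoScaleNumerator β Λ₁ Λ₂ x u) (ppTwoScaleNumeratorDu β Λ₂ Λ₁ u e) e := by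
  have h := hasDerivAt_ppTwoScaleNumerator_u hβ hΛ₁ hB₁ (Λ₁ := Λ₂) u e
  have hfun : (fun x => ppTwoScaleNumerator β Λ₁ Λ₂ x u) = fun x => ppTwoScaleNumerator β Λ₂ Λ₁ u x :=
    funext fun x => ppTwoScaleNumerator_symm β Λ₁ Λ₂ x u
  rw [hfun]
  exact h

end Summit.HubbardSuperconductivity.HubbardSuperconductivity.Theorems.C4a

end
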